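import Mathlib
import HarnessLib
import Summits.NavierStokesRegularity.NavierStokesRegularity.Theorems.PoloidalWindowDoorLrcModEntireJetCertRelabelParts
import Summits.NavierStokesRegularity.NavierStokesRegularity.Theorems.PoloidalWindowDoorLrcModEntireTHCertSteady
import Summits.NavierStokesRegularity.NavierStokesRegularity.Theorems.PoloidalWindowDoorLrcModEntireTHCertSliceUD8TData
import Summits.NavierStokesRegularity.NavierStokesRegularity.Theorems.PoloidalWindowDoorLrcModEntireTHCertSliceUD8TCheckA
import Summits.NavierStokesRegularity.NavierStokesRegularity.Theorems.PoloidalWindowDoorLrcModEntireTHCertSliceUD8TCheckB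

/-!
# Route `PoloidalWindowDoor`, item `LrcModEntire` (stmt-NavierStokesRegularity-20428) — THE UNSTEADY (TH) LOCAL DATUM IN SLICE LETTERS WITH TIME JETS OF ORDER ≤ 3
# (`UD8T`): the relabeling certificate CHECKED BY PARTS, reassembled, and the registered-currency datum transferred

Cell ns-regularity-ideate, seat ns-k2-port-2 g2 (kernel-port lineage under the LEAD of item 20428, ns-poloidal-K2-p3 g11; `--supports stmt-NavierStokesRegularity-20428`;
compute-cert lane: the `native_decide`s carry `Lean.ofReduceBool`, accepted for this item by DIRECTOR-NS #76 (1)).  Data: `…THCertSliceUD8TData` (264 letters: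
UD8's 189 + the time jets `at, wtt, ftt, mtt, att, wttt, fttt, mttt, attt`; 774 table identities).

* `sliceRelabel_checkDir0…3`, `sliceRelabel_checkHyps`, `sliceRelabel_checkPins` — the parts (`…JetCertRelabelParts`), each ONE `native_decide`;
* `sliceRelabel_check` — `relabelCheck … sliceRelabel = true` by `relabelCheck_of_parts`;
* `thSliceLocalDatum` — **the non-umbilic (TH) local datum in the 264 slice letters** (registered unsteady hypotheses of `stub_localTHEmptyHypNUG(RS)` except the
  gauge conditions at `p₀`, which the gauge sequel `…THCertSliceGaugeUD8T` adds as point-zero / point-value letters): `LocalDatum 264 sliceRelabel.Sf sliceRelabel.Mf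
  dirVec [E'] [twist, μ, μ−1, μ_z, Π_NU]` via `…THCertExtra.thLocalDatum_with` ∘ `…JetCertRelabel.LocalDatum.relabel`;
* `slice_false_of_checkTreeS/C` — a tree checked in these letters against `E' ∷ Ts` refutes the (chunk-extended) datum.

THE RULE THIS BUYS (DYNAMIC-ROWS-g11 §3 «∂ₜ of a certified row is a certified row»): in these tables a certified slice law `T` (a chunk law, e.g. a static row of
`…THCertSliceUGens*/USlaw*` re-derived here) may be differentiated along direction `0` — word `[0]` in a STEP — whenever all its letters are `t`-tabled, i.e. have
time order ≤ 2 and lie in the ranges above; the result is the INERTIAL-frame time derivative `Σ_ℓ (∂T/∂ℓ)·ℓₜ` with `wₜ, fₜ, mₜ, aₜ, wₜₜ, …` as LETTERS (the E-rows then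
express `wt_ab`, and `∂_z wt = −4(a+1)(b+1)ft` the mixed `ft`, in static letters; the pure `ft_d0`, the `mtt_j` and the `at_j` stay free — cf. the LEAD's `p, q, b`).  The
co-moving frame of DYNAMIC-ROWS-g11 §2 (`u(t, X(t)) ≡ 0`) is NOT a gauge available here (it needs the analytic particle path; successor item): certificates must be
produced in the inertial variant (Galilean/RS gauge AT `p₀` only: zero letters `Rw_0_0, Rf_1_0, If_1_0` (+ `Rw_1_0`, value `Iw_1_0 = −1/2`), NO zero letters among the
time jets).
WHAT THIS IS NOT: not a claim about Navier–Stokes and not a certificate of emptiness — the change of letters, certified. [folklore]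
-/

set_option maxRecDepth 100000

-- the summit and its single sub-problem share the name (CONVENTIONS §1), as in every Theorems file
set_option linter.dupNamespace false

namespace Summit.NavierStokesRegularity.NavierStokesRegularity.Theorems.PoloidalWindowDoorLrcModEntireTHCertSliceUD8T

open Summit.NavierStokesRegularity.NavierStokesRegularity.Theorems.PoloidalWindowDoorLrcModEntireJetCertDefs
open Summit.NavierStokesRegularity.NavierStokesRegularity.Theorems.PoloidalWindowDoorLrcModEntireJetCertMasked
open Summit.NavierStokesRegularity.NavierStokesRegularity.Theorems.PoloidalWindowDoorLrcModEntireJetCertTree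
open Summit.NavierStokesRegularity.NavierStokesRegularity.Theorems.PoloidalWindowDoorLrcModEntireJetCertFast2
open Summit.NavierStokesRegularity.NavierStokesRegularity.Theorems.PoloidalWindowDoorLrcModEntireJetCertCancel
open Summit.NavierStokesRegularity.NavierStokesRegularity.Theorems.PoloidalWindowDoorLrcModEntireJetCertRelabel
open Summit.NavierStokesRegularity.NavierStokesRegularity.Theorems.PoloidalWindowDoorLrcModEntireJetCertRelabelParts
open Summit.NavierStokesRegularity.NavierStokesRegularity.Theorems.PoloidalWindowDoorLrcModEntireTHCertLetters
open Summit.NavierStokesRegularity.NavierStokesRegularity.Theorems.PoloidalWindowDoorLrcModEntireTHCert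
open Summit.NavierStokesRegularity.NavierStokesRegularity.Theorems.PoloidalWindowDoorLrcModEntireTHCertSteady
open Summit.NavierStokesRegularity.NavierStokesRegularity.Theorems.PoloidalWindowDoorLrcModEntireTHCertExtra
open scoped InnerProductSpace Laplacian
open Summit.NavierStokesRegularity.NavierStokesRegularity.Theorems.PoloidalWindowDoorLrcModEntireTHCertSliceUD8TData
open Summit.NavierStokesRegularity.NavierStokesRegularity.Theorems.PoloidalWindowDoorLrcModEntireTHCertSliceUD8TCheckA
open Summit.NavierStokesRegularity.NavierStokesRegularity.Theorems.PoloidalWindowDoorLrcModEntireTHCertSliceUD8TCheckB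

/-- Table transfer, direction `t` (`146` identities; one `native_decide`). [folklore] -/
theorem sliceRelabel_checkDir0 : relabelCheckDir sliceLetters.length (tableOf sliceLetters) (maskOf sliceLetters) (thHyps sliceLetters) sliceRelabel 0 = true := by
  native_decide

/-- Law transfer (`E'`; one `native_decide`). [folklore] -/
theorem sliceRelabel_checkHyps : relabelCheckHyps sliceLetters.length (tableOf sliceLetters) (maskOf sliceLetters) (thHyps sliceLetters) sliceRelabel = true := by
  native_decide

/-- Pin transfer (`[twist, μ, μ−1, μ_z, Π_NU]`; one `native_decide`). [folklore] -/
theorem sliceRelabel_checkPins : relabelCheckPins sliceLetters.length (tableOf sliceLetters) (maskOf sliceLetters) (thHyps sliceLetters) (thPins sliceLetters ++ [pinNonUmbilic sliceLetters]) sliceRelabel = true := by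
  native_decide

/-- The mask list has the four directions. [folklore] -/
theorem sliceRelabel_M'_length : sliceRelabel.M'.length = 4 := rfl

/-- **The relabeling certificate checks** (reassembled from the parts). [folklore] -/
theorem sliceRelabel_check :
    relabelCheck sliceLetters.length (tableOf sliceLetters) (maskOf sliceLetters) (thHyps sliceLetters) (thPins sliceLetters ++ [pinNonUmbilic sliceLetters]) sliceRelabel = true :=
  relabelCheck_of_parts sliceRelabel
    (by rw [sliceRelabel_M'_length]
        exact forall_lt_four sliceRelabel_checkDir0 sliceRelabel_checkDir1 sliceRelabel_checkDir2 sliceRelabel_checkDir3)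
    sliceRelabel_checkHyps sliceRelabel_checkPins

/-- **THE NON-UMBILIC (TH) LOCAL DATUM IN SLICE LETTERS WITH TIME JETS (unsteady = registered currency).**  Hypotheses = those of the registered stub
`stub_localTHEmptyHypNUGRS` (twist_split v4.3/v5) except the sign and the gauge conditions at `p₀`; conclusion = a `LocalDatum` in the 264 slice letters with the
single hypothesis law `E'` and the five pins. [folklore] -/
theorem thSliceLocalDatum
    {u : ℝ → EuclideanSpace ℝ (Fin 3) → EuclideanSpace ℝ (Fin 3)} {μ A : ℝ → ℝ → ℝ}
    {U : Set (ℝ × EuclideanSpace ℝ (Fin 3))} {p₀ : ℝ × EuclideanSpace ℝ (Fin 3)} (hU : IsOpen U) (hp₀ : p₀ ∈ U)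
    (hu : AnalyticOnNhd ℝ (Function.uncurry u) U)
    (hμ : ∀ p ∈ U, AnalyticAt ℝ (Function.uncurry μ) (p.1, p.2 2)) (hA : ∀ p ∈ U, AnalyticAt ℝ (Function.uncurry A) (p.1, p.2 2))
    (hpol : ∀ p ∈ U, fderiv ℝ (u p.1) p.2 (EuclideanSpace.single 0 1) 1 = fderiv ℝ (u p.1) p.2 (EuclideanSpace.single 1 1) 0)
    (hdiv : ∀ p ∈ U, fderiv ℝ (u p.1) p.2 (EuclideanSpace.single 0 1) 0 + fderiv ℝ (u p.1) p.2 (EuclideanSpace.single 1 1) 1 +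
      fderiv ℝ (u p.1) p.2 (EuclideanSpace.single 2 1) 2 = 0)
    (hsh : ∀ p ∈ U, ∀ b : Fin 3, b ≠ 2 →
      fderiv ℝ (u p.1) p.2 (EuclideanSpace.single 2 1) b = μ p.1 (p.2 2) * fderiv ℝ (u p.1) p.2 (EuclideanSpace.single b 1) 2)
    (hE : ∀ p ∈ U,
      (1 - μ p.1 (p.2 2)) *
          (deriv (fun s => u s p.2 2) p.1 + fderiv ℝ (fun y => u p.1 y 2) p.2 (u p.1 p.2) - Δ (fun y => u p.1 y 2) p.2) =
        A p.1 (p.2 2) + (deriv (fun s => μ s (p.2 2)) p.1 - deriv (deriv (μ p.1)) (p.2 2)) * u p.1 p.2 2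
          + deriv (μ p.1) (p.2 2) / 2 * u p.1 p.2 2 ^ 2 - 2 * deriv (μ p.1) (p.2 2) * fderiv ℝ (u p.1) p.2 (EuclideanSpace.single 2 1) 2)
    (htw : fderiv ℝ (fun y => fderiv ℝ (u p₀.1) y (EuclideanSpace.single 2 1) 2) p₀.2 (EuclideanSpace.single 0 1) *
            fderiv ℝ (u p₀.1) p₀.2 (EuclideanSpace.single 1 1) 2 -
          fderiv ℝ (fun y => fderiv ℝ (u p₀.1) y (EuclideanSpace.single 2 1) 2) p₀.2 (EuclideanSpace.single 1 1) *
            fderiv ℝ (u p₀.1) p₀.2 (EuclideanSpace.single 0 1) 2 ≠ 0)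
    (hm0 : μ p₀.1 (p₀.2 2) ≠ 0) (hm1 : μ p₀.1 (p₀.2 2) ≠ 1) (hmz : deriv (μ p₀.1) (p₀.2 2) ≠ 0)
    (hNU : fderiv ℝ (u p₀.1) p₀.2 (EuclideanSpace.single 0 1) 0 ≠ fderiv ℝ (u p₀.1) p₀.2 (EuclideanSpace.single 1 1) 1 ∨
      fderiv ℝ (u p₀.1) p₀.2 (EuclideanSpace.single 1 1) 0 ≠ 0) :
    LocalDatum (E := ℝ × EuclideanSpace ℝ (Fin 3)) sliceRelabel.m sliceRelabel.Sf sliceRelabel.Mf dirVec sliceRelabel.hyps' sliceRelabel.pins' :=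
  LocalDatum.relabel sliceRelabel sliceRelabel_check (by
    simpa using thLocalDatum_with sliceLetters sliceLetters_ok hU hp₀ hu hμ hA hpol hdiv hsh hE htw hm0 hm1 hmz [] [pinNonUmbilic sliceLetters]
      (by simp) (fun π hπ => by
        simp only [List.mem_cons, List.mem_nil_iff, or_false] at hπ
        subst hπ
        exact pinNonUmbilic_ne_zero sliceLetters_ok hu hp₀ hNU))

/-- A tree checked IN THESE SLICE LETTERS against `E' ++ Ts` and the five pins refutes the slice datum (chunk-extended). [folklore] -/
theorem slice_false_of_checkTreeS (Ts : List Literature.Analysis.ValidatedNumerics.QMvPoly) (t : CertTree)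
    (ht : checkTreeS sliceRelabel.m sliceRelabel.Sf sliceRelabel.Mf (sliceRelabel.hyps' ++ Ts) sliceRelabel.pins' t = true)
    (hdat : LocalDatum (E := ℝ × EuclideanSpace ℝ (Fin 3)) sliceRelabel.m sliceRelabel.Sf sliceRelabel.Mf dirVec
      (sliceRelabel.hyps' ++ Ts) sliceRelabel.pins') : False :=
  not_localDatum_of_checkTreeS t _ _ ht hdat

/-- The same with cancellation nodes. [folklore] -/
theorem slice_false_of_checkTreeC (Ts : List Literature.Analysis.ValidatedNumerics.QMvPoly) (t : CertTreeC)
    (ht : checkTreeC sliceRelabel.m sliceRelabel.Sf sliceRelabel.Mf (sliceRelabel.hyps' ++ Ts) sliceRelabel.pins' t = true)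
    (hdat : LocalDatum (E := ℝ × EuclideanSpace ℝ (Fin 3)) sliceRelabel.m sliceRelabel.Sf sliceRelabel.Mf dirVec
      (sliceRelabel.hyps' ++ Ts) sliceRelabel.pins') : False :=
  not_localDatum_of_checkTreeC t _ _ ht hdat

end Summit.NavierStokesRegularity.NavierStokesRegularity.Theorems.PoloidalWindowDoorLrcModEntireTHCertSliceUD8T
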